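import Summits.CriticalPhenomena.PercolationContinuityZ3.Theorems.SahiAESeparableTiltCoord
import Summits.CriticalPhenomena.PercolationContinuityZ3.Theorems.SahiAECornerEnvelope

/-!
# The separable tilt, and a BOREL everywhere-MTP₂ version of an a.e.-MTP₂ density (Lebesgue reference)

Support file of the Sahi cell (`prim-sahi`): literature seat gen35's kernel file `SahiAESeparableTilt.lean`
(evidence n°8688 on `stmt-CriticalPhenomena-4575`, sha256 `af5f8450…be96`, 1048 lines), landed by a prover seat in FOUR
parts because tree `Theorems/` files are capped at 400 lines: `SahiAESeparableTiltPrelim`, `SahiAESeparableTiltLowerSet`,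
`SahiAESeparableTiltCoord`, `SahiAESeparableTilt` (main theorems).  Every declaration is byte-identical to the evidence
file and keeps its namespace `…Theorems.SahiAESeparableTilt`; only imports, module docstrings and the grouping of the
sections into files differ.  Theorems only (no definitions, no named facts, no sorries).
This is part 4/4 (sections `Main`, `Multiplicative`, `BorelVersion` of the evidence file): the three main theorems;
parts 1–3 (`SahiAESeparableTiltPrelim`, `SahiAESeparableTiltLowerSet`, `SahiAESeparableTiltCoord`) hold steps 1–5
of the architecture below.

Context.  `Theorems/SahiAEVersion.lean` (`exists_mtp2_version_of_ae`, typer g20): a bounded measurable density on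
`ℝ^ι` which is MTP₂ on Lebesgue-almost every pair has a version MTP₂ at EVERY pair — an ultrafilter limit, hence
only a.e.-measurable; the Borel question was left open there, and is not treated in print (Karlin–Rinott 1980 (1.4),
Müller–Stoyan 2002 (3.10.8), Fuchs–Wang 2026 p. 2 DEFINE MTP₂ through an everywhere version; Batty–Bollmann 1980
handle the a.e. hypothesis at the level of the integral inequalities; cell LITERATURE.md §39).
`Theorems/SahiAECornerEnvelope.lean` (`exists_measurable_mtp2_version_of_ae_monotone`, typer g20) settles it for
densities that are IN ADDITION non-decreasing on almost every comparable pair (the lower-corner essential envelope).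
This file removes the monotonicity hypothesis for densities bounded away from `0` and `∞`:

* `exists_separable_tilt_ae_monotone` — **the separable tilt** (additive form): a bounded measurable
  `φ : ℝ^ι → ℝ`, supermodular on `λ ⊗ λ`-a.e. pair, becomes non-decreasing on `λ ⊗ λ`-a.e. comparable pair after
  subtracting measurable bounded functions of one coordinate, `G = φ − Σᵢ aᵢ(xᵢ)` (a modular correction, so `G` is
  still a.e.-supermodular).
* `exists_separable_tilt_mtp2` — multiplicative form: `f = g · ∏ᵢ uᵢ(xᵢ)` with `g` a.e.-MTP₂ AND a.e.-monotone,
  bounded, measurable (`0 < c ≤ f ≤ M < ∞`).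
* `exists_measurable_mtp2_version_of_ae_of_pos` — **R5: a measurable `f : ℝ^ι → [c, M]`, `0 < c`, `M < ∞`, which is
  MTP₂ on Lebesgue-almost every pair has a BOREL bounded version `F = f` a.e. with `F(x)F(y) ≤ F(x ∧ y)F(x ∨ y)` at
  EVERY pair** (`F = F₀ · ∏ᵢ uᵢ(xᵢ)`, `F₀` the corner envelope of `g`).

Architecture of the tilt (coordinate `i`; `D(r,s,x) = φ(update x i s) − φ(update x i r)`,
`A(r,s) = ess inf_x D(r,s,x)`):
1. `ae_incrDiff_of_ae_supermodular` — increasing differences: for a.e. `(r,s)`, `r ≤ s`, `x ↦ D(r,s,x)` is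
   non-decreasing on a.e. comparable pair (the a.e. hypothesis pulled back along the quasi-measure-preserving
   surgery `((r,s),(x,y)) ↦ (update x i s, update y i r)`; `quasiMeasurePreserving_update` rests on the
   dummy-coordinate identity `lintegral_lintegral_update`: `∫_x ∫_r g(update x i r) = ⊤ · ∫ g`).  All pairs used are
   GENERIC: the a.e.-pair hypothesis is never instantiated at partially diagonal pairs such as `(x ∧ y, x)`.
2. `essInf_add_ge` / `essInf_add_le_of_ae_monotone` — `A` is super-additive on all triples and SUB-additive on
   triples whose links are good: the near-infimum sets `{D < A + δ}` are ESSENTIAL down-sets of positive measure;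
   `exists_isLowerSet_ae_eq` — an essential down-set of `ℝ^ι` equals a.e. the genuine down-set
   `{x : λ(W ∩ [x,∞)) > 0}` (Fubini one way, Lebesgue density points the other way: the upper corner `[x, x+r]` is a
   `2^{-|ι|}`-th of the sup-norm ball); `volume_inter_ne_zero_of_isLowerSet` — Harris' inequality for down-sets
   (the everywhere four functions theorem `Literature…lintegral_four_functions`, [KarlinRinott1980, Thm. 2.1]).
3. `exists_potential_of_cocycle` — a bounded measurable cocycle (super-additive everywhere, sub-additive on good
   chains, a.e. pair good) has a potential from a generic base point: `a(t) − a(r) ≤ A(r,t)` for a.e. good `r ≤ t`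
   (`measurable_essInf_of_bounded`: measurability of a parametrised essential infimum).
4. `ae_coord_monotone_of_tilt` — the coordinatewise statement "`G(x) ≤ G(update x i s)` for a.e. `(x,s)`,
   `xᵢ ≤ s`": the diagonal substitution `r := xᵢ` is legitimate by the dummy-coordinate identity, because `D` does
   not read the `i`-th coordinate of its base point.
5. `ae_monotone_of_ae_coord_monotone` — globalisation along the coordinate gluings `S.piecewise y x`
   (`measurePreserving_piecewise_pair_volume` of `SahiAECornerEnvelopePrelim.lean`).

Lebesgue measure is used (beyond product structure and σ-finiteness) exactly in step 2 (density points) — and in the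
corner envelope; for finite products of other reference measures see the cell notes (diffuse factors reduce to
Lebesgue through the coordinatewise distribution-function map).  What is NOT claimed: densities with zeros or not
bounded away from `0` / `∞` (the logarithm must be bounded for the cocycle), general product reference measures.
No sorries, no new axioms (`#print axioms`: propext, Classical.choice, Quot.sound).
-/

noncomputable section

namespace Summit.CriticalPhenomena.PercolationContinuityZ3.Theorems.SahiAESeparableTilt

open MeasureTheory Set Filter Topology Metric Function
open Summit.CriticalPhenomena.PercolationContinuityZ3.Theorems.SahiAEFourFunctions
open scoped ENNReal NNReal

variable {ι : Type*} [Fintype ι]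

/-! ### The separable tilt theorem -/

section Main

/-- **The per-coordinate potential.**  For `φ : ℝ^ι → ℝ` measurable with `|φ| ≤ K` and supermodular on almost every
pair, and a coordinate `i`, there is a measurable `a : ℝ → [−2K, 2K]` with
`a(s) − a(r) ≤ φ(update x i s) − φ(update x i r)` for almost every `(r, s)` with `r ≤ s` and almost every `x`:
`a` is the potential (`exists_potential_of_cocycle`) of the cocycle `A(r,s) = ess inf_x [φ(update x i s) − φ(update x i r)]`
(super-additive everywhere, sub-additive on good chains by `essInf_add_le_of_ae_monotone`, good pairs a.e. by
`ae_incrDiff_of_ae_supermodular`). [this work] -/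
theorem exists_coord_potential [DecidableEq ι] (φ : (ι → ℝ) → ℝ) (hφ : Measurable φ) {K : ℝ}
    (hK : ∀ x, |φ x| ≤ K)
    (hsm : ∀ᵐ p ∂(volume : Measure (ι → ℝ)).prod volume, φ p.1 + φ p.2 ≤ φ (p.1 ⊓ p.2) + φ (p.1 ⊔ p.2))
    (i : ι) :
    ∃ a : ℝ → ℝ, Measurable a ∧ (∀ t, |a t| ≤ 2 * K) ∧
      ∀ᵐ rs ∂(volume : Measure ℝ).prod (volume : Measure ℝ), ∀ᵐ x ∂(volume : Measure (ι → ℝ)),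
        rs.1 ≤ rs.2 → a rs.2 - a rs.1 ≤ φ (update x i rs.2) - φ (update x i rs.1) := by
  have hvolE : (volume : Measure (ι → ℝ)) ≠ 0 := volume_pi_ne_zero
  have hD : ∀ (r s : ℝ) (x : ι → ℝ), |φ (update x i s) - φ (update x i r)| ≤ 2 * K := by
    intro r s x
    have h1 := abs_le.1 (hK (update x i s))
    have h2 := abs_le.1 (hK (update x i r))
    rw [abs_le]
    constructor <;> linarith
  have hDm : ∀ r s : ℝ, Measurable fun x : ι → ℝ => φ (update x i s) - φ (update x i r) := fun r s =>
    (hφ.comp measurable_update_left).sub (hφ.comp measurable_update_left)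
  have hF : Measurable fun w : (ℝ × ℝ) × (ι → ℝ) => φ (update w.2 i w.1.2) - φ (update w.2 i w.1.1) :=
    (hφ.comp (measurable_update'.comp (measurable_snd.prodMk (measurable_snd.comp measurable_fst)))).sub
      (hφ.comp (measurable_update'.comp (measurable_snd.prodMk (measurable_fst.comp measurable_fst))))
  have hlo : ∀ w : (ℝ × ℝ) × (ι → ℝ), -(2 * K) ≤ φ (update w.2 i w.1.2) - φ (update w.2 i w.1.1) :=
    fun w => (abs_le.1 (hD w.1.1 w.1.2 w.2)).1
  have hhi : ∀ w : (ℝ × ℝ) × (ι → ℝ), φ (update w.2 i w.1.2) - φ (update w.2 i w.1.1) ≤ 2 * K :=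
    fun w => (abs_le.1 (hD w.1.1 w.1.2 w.2)).2
  have hAm : Measurable fun p : ℝ × ℝ =>
      essInf (fun x : ι → ℝ => φ (update x i p.2) - φ (update x i p.1)) (volume : Measure (ι → ℝ)) :=
    measurable_essInf_of_bounded (F := fun (p : ℝ × ℝ) (x : ι → ℝ) => φ (update x i p.2) - φ (update x i p.1))
      hvolE hF (fun p x => hlo (p, x)) (fun p x => hhi (p, x))
  have hAB : ∀ r s : ℝ,
      |essInf (fun x : ι → ℝ => φ (update x i s) - φ (update x i r)) (volume : Measure (ι → ℝ))| ≤ 2 * K :=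
    fun r s => abs_essInf_le (hD r s) hvolE
  have etel : ∀ r s t : ℝ, (fun x : ι → ℝ => (φ (update x i s) - φ (update x i r)) +
      (φ (update x i t) - φ (update x i s))) = fun x => φ (update x i t) - φ (update x i r) := by
    intro r s t
    funext x
    ring
  have hsuper : ∀ r s t : ℝ,
      essInf (fun x : ι → ℝ => φ (update x i s) - φ (update x i r)) (volume : Measure (ι → ℝ)) +
        essInf (fun x : ι → ℝ => φ (update x i t) - φ (update x i s)) (volume : Measure (ι → ℝ)) ≤
        essInf (fun x : ι → ℝ => φ (update x i t) - φ (update x i r)) (volume : Measure (ι → ℝ)) := by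
    intro r s t
    have h := essInf_add_ge hvolE (hD r s) (hD s t)
    rw [etel r s t] at h
    exact h
  have hP := ae_incrDiff_of_ae_supermodular i hsm
  have hsub : ∀ r s t : ℝ, r ≤ s → s ≤ t →
      (∀ᵐ p ∂(volume : Measure (ι → ℝ)).prod volume, p.1 ≤ p.2 →
        φ (update p.1 i s) - φ (update p.1 i r) ≤ φ (update p.2 i s) - φ (update p.2 i r)) →
      (∀ᵐ p ∂(volume : Measure (ι → ℝ)).prod volume, p.1 ≤ p.2 →
        φ (update p.1 i t) - φ (update p.1 i s) ≤ φ (update p.2 i t) - φ (update p.2 i s)) →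
      essInf (fun x : ι → ℝ => φ (update x i t) - φ (update x i r)) (volume : Measure (ι → ℝ)) ≤
        essInf (fun x : ι → ℝ => φ (update x i s) - φ (update x i r)) (volume : Measure (ι → ℝ)) +
          essInf (fun x : ι → ℝ => φ (update x i t) - φ (update x i s)) (volume : Measure (ι → ℝ)) := by
    intro r s t _ _ h1 h2
    have h := essInf_add_le_of_ae_monotone (hDm r s) (hDm s t) (hD r s) (hD s t) h1 h2
    rw [etel r s t] at h
    exact h
  obtain ⟨a, ham, hab, hap⟩ := exists_potential_of_cocycle
    (A := fun r s => essInf (fun x : ι → ℝ => φ (update x i s) - φ (update x i r)) (volume : Measure (ι → ℝ)))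
    hAm hAB
    (fun r s => ∀ᵐ p ∂(volume : Measure (ι → ℝ)).prod volume, p.1 ≤ p.2 →
      φ (update p.1 i s) - φ (update p.1 i r) ≤ φ (update p.2 i s) - φ (update p.2 i r))
    hP hsuper hsub
  refine ⟨a, ham, hab, ?_⟩
  filter_upwards [hP, hap] with rs h1 h2
  have hE1 : ∀ᵐ x ∂(volume : Measure (ι → ℝ)),
      essInf (fun x : ι → ℝ => φ (update x i rs.2) - φ (update x i rs.1)) (volume : Measure (ι → ℝ)) ≤
        φ (update x i rs.2) - φ (update x i rs.1) :=
    ae_essInf_le_of_forall_le (fun x => (abs_le.1 (hD rs.1 rs.2 x)).1)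
  filter_upwards [hE1] with x hx hle
  exact (h2 hle (h1 hle)).trans hx

/-- **THE SEPARABLE TILT (R5, STEP 1).**  Let `φ : ℝ^ι → ℝ` be measurable, `|φ| ≤ K`, and supermodular on
Lebesgue-almost every pair: `φ(x) + φ(y) ≤ φ(x ∧ y) + φ(x ∨ y)` for `λ ⊗ λ`-a.e. `(x, y)`.  Then there are measurable
`a_i : ℝ → [−2K, 2K]` such that `G := φ − Σ_i a_i(x_i)` is non-decreasing on `λ ⊗ λ`-almost every comparable pair.
(`Σ_i a_i(x_i)` is modular, so `G` is still a.e.-supermodular and bounded.)  Construction: for each coordinate `i`,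
`A_i(r,s) = ess inf_x [φ(update x i s) − φ(update x i r)]` is an additive cocycle on almost every chain
(super-additivity is trivial; sub-additivity is Harris' inequality for the essential down-sets where the two
a.e.-monotone increments are near their essential infima), and `a_i` is its potential from a generic base point;
the coordinatewise statement follows by the dummy-coordinate identity and globalises along coordinate gluings.
[this work] -/
theorem exists_separable_tilt_ae_monotone (φ : (ι → ℝ) → ℝ) (hφ : Measurable φ) {K : ℝ} (hK : ∀ x, |φ x| ≤ K)
    (hsm : ∀ᵐ p ∂(volume : Measure (ι → ℝ)).prod volume, φ p.1 + φ p.2 ≤ φ (p.1 ⊓ p.2) + φ (p.1 ⊔ p.2)) :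
    ∃ a : ι → ℝ → ℝ, (∀ i, Measurable (a i)) ∧ (∀ i t, |a i t| ≤ 2 * K) ∧
      ∀ᵐ p ∂(volume : Measure (ι → ℝ)).prod volume, p.1 ≤ p.2 →
        φ p.1 - ∑ i, a i (p.1 i) ≤ φ p.2 - ∑ i, a i (p.2 i) := by
  classical
  choose a ham hab hap using exists_coord_potential φ hφ hK hsm
  refine ⟨a, ham, hab, ?_⟩
  have hcoord : ∀ i, ∀ᵐ q ∂(volume : Measure (ι → ℝ)).prod (volume : Measure ℝ),
      q.1 i ≤ q.2 → φ q.1 - ∑ j, a j (q.1 j) ≤ φ (update q.1 i q.2) - ∑ j, a j (update q.1 i q.2 j) :=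
    fun i => ae_coord_monotone_of_tilt hφ ham i (hap i)
  exact ae_monotone_of_ae_coord_monotone (G := fun x => φ x - ∑ j, a j (x j)) hcoord

end Main

/-! ### Multiplicative form: the separable tilt of an a.e.-MTP₂ density bounded away from `0` and `∞` -/

section Multiplicative

omit [Fintype ι] in
/-- A separable product `∏ᵢ uᵢ(xᵢ)` is multiplicatively modular: `U(x) U(y) = U(x ∧ y) U(x ∨ y)`. [folklore] -/
theorem prod_mul_prod_eq_inf_sup [Fintype ι] (u : ι → ℝ → ℝ≥0∞) (x y : ι → ℝ) :
    (∏ i, u i (x i)) * (∏ i, u i (y i)) = (∏ i, u i ((x ⊓ y) i)) * (∏ i, u i ((x ⊔ y) i)) := by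
  rw [← Finset.prod_mul_distrib, ← Finset.prod_mul_distrib]
  refine Finset.prod_congr rfl fun i _ => ?_
  simp only [Pi.inf_apply, Pi.sup_apply]
  rcases le_total (x i) (y i) with h | h
  · rw [inf_eq_left.2 h, sup_eq_right.2 h]
  · rw [inf_eq_right.2 h, sup_eq_left.2 h, mul_comm]

/-- **The separable tilt, multiplicative form (input shape of `exists_measurable_mtp2_version_of_ae_monotone`).**
A measurable `f : ℝ^ι → [c, M]` (`0 < c`, `M < ∞`) which is MTP₂ on Lebesgue-almost every pair factors as
`f = g · ∏ᵢ uᵢ(xᵢ)` with `uᵢ : ℝ → (0, M']` measurable and `g ≤ M'` measurable, MTP₂ on almost every pair AND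
non-decreasing on almost every comparable pair (`g = exp(φ − Σᵢ aᵢ(xᵢ))`, `φ = log f`,
`exists_separable_tilt_ae_monotone`). [this work] -/
theorem exists_separable_tilt_mtp2 (f : (ι → ℝ) → ℝ≥0∞) (hf : Measurable f) {c M : ℝ≥0∞} (hc : c ≠ 0)
    (hM : M ≠ ∞) (hcf : ∀ x, c ≤ f x) (hfM : ∀ x, f x ≤ M)
    (hMTP : ∀ᵐ p ∂(volume : Measure (ι → ℝ)).prod volume, f p.1 * f p.2 ≤ f (p.1 ⊓ p.2) * f (p.1 ⊔ p.2)) :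
    ∃ (u : ι → ℝ → ℝ≥0∞) (g : (ι → ℝ) → ℝ≥0∞) (M' : ℝ≥0∞), (∀ i, Measurable (u i)) ∧
      (∀ i t, u i t ≠ 0 ∧ u i t ≤ M') ∧ Measurable g ∧ M' ≠ ∞ ∧ (∀ x, g x ≤ M') ∧
      (∀ x, f x = g x * ∏ i, u i (x i)) ∧
      (∀ᵐ p ∂(volume : Measure (ι → ℝ)).prod volume, g p.1 * g p.2 ≤ g (p.1 ⊓ p.2) * g (p.1 ⊔ p.2)) ∧
      (∀ᵐ p ∂(volume : Measure (ι → ℝ)).prod volume, p.1 ≤ p.2 → g p.1 ≤ g p.2) := by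
  classical
  have hcT : c ≠ ∞ := ne_top_of_le_ne_top hM ((hcf fun _ => 0).trans (hfM _))
  have hfT : ∀ x, f x ≠ ∞ := fun x => ne_top_of_le_ne_top hM (hfM x)
  have hf0 : ∀ x, f x ≠ 0 := fun x => (lt_of_lt_of_le (pos_iff_ne_zero.2 hc) (hcf x)).ne'
  have hpos : ∀ x, 0 < (f x).toReal := fun x => ENNReal.toReal_pos (hf0 x) (hfT x)
  -- `φ = log f`
  set φ : (ι → ℝ) → ℝ := fun x => Real.log (f x).toReal with hφdef
  have hφm : Measurable φ := Real.measurable_log.comp (ENNReal.measurable_toReal.comp hf)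
  set K : ℝ := max |Real.log c.toReal| |Real.log M.toReal| with hKdef
  have hK0 : 0 ≤ K := le_max_of_le_left (abs_nonneg _)
  have hK : ∀ x, |φ x| ≤ K := by
    intro x
    have h1 : Real.log c.toReal ≤ φ x :=
      Real.log_le_log (ENNReal.toReal_pos hc hcT) (ENNReal.toReal_mono (hfT x) (hcf x))
    have h2 : φ x ≤ Real.log M.toReal := Real.log_le_log (hpos x) (ENNReal.toReal_mono hM (hfM x))
    rw [abs_le]
    constructor
    · have h3 : -K ≤ -|Real.log c.toReal| := neg_le_neg (le_max_left _ _)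
      exact h3.trans ((neg_abs_le _).trans h1)
    · exact h2.trans ((le_abs_self _).trans (le_max_right _ _))
  -- a.e. supermodularity of `φ`
  have hsm : ∀ᵐ p ∂(volume : Measure (ι → ℝ)).prod volume, φ p.1 + φ p.2 ≤ φ (p.1 ⊓ p.2) + φ (p.1 ⊔ p.2) := by
    filter_upwards [hMTP] with p hp
    have h := ENNReal.toReal_mono (ENNReal.mul_ne_top (hfT _) (hfT _)) hp
    rw [ENNReal.toReal_mul, ENNReal.toReal_mul] at h
    have h' := Real.log_le_log (mul_pos (hpos _) (hpos _)) h
    rw [Real.log_mul (hpos _).ne' (hpos _).ne', Real.log_mul (hpos _).ne' (hpos _).ne'] at h'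
    exact h'
  obtain ⟨a, ham, hab, hmono⟩ := exists_separable_tilt_ae_monotone φ hφm hK hsm
  have hexpφ : ∀ x, ENNReal.ofReal (Real.exp (φ x)) = f x := fun x => by
    simp only [hφdef]
    rw [Real.exp_log (hpos x), ENNReal.ofReal_toReal (hfT x)]
  refine ⟨fun i t => ENNReal.ofReal (Real.exp (a i t)), fun x => ENNReal.ofReal (Real.exp (φ x - ∑ i, a i (x i))),
    ENNReal.ofReal (Real.exp (K + ∑ _i : ι, 2 * K)), ?_, ?_, ?_, ENNReal.ofReal_ne_top, ?_, ?_, ?_, ?_⟩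
  · intro i
    exact ENNReal.measurable_ofReal.comp (Real.measurable_exp.comp (ham i))
  · intro i t
    refine ⟨(ENNReal.ofReal_pos.2 (Real.exp_pos _)).ne', ENNReal.ofReal_le_ofReal (Real.exp_le_exp.2 ?_)⟩
    have h1 : a i t ≤ 2 * K := (le_abs_self _).trans (hab i t)
    have h2 : 2 * K ≤ ∑ _j : ι, 2 * K :=
      Finset.single_le_sum (f := fun _ : ι => 2 * K) (fun j _ => by positivity) (Finset.mem_univ i)
    linarith
  · exact ENNReal.measurable_ofReal.comp (Real.measurable_exp.comp
      (hφm.sub (Finset.measurable_sum _ fun i _ => (ham i).comp (measurable_pi_apply i))))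
  · intro x
    refine ENNReal.ofReal_le_ofReal (Real.exp_le_exp.2 ?_)
    have h1 : φ x ≤ K := (le_abs_self _).trans (hK x)
    have h2 : -∑ i, a i (x i) ≤ ∑ _i : ι, 2 * K := by
      rw [← Finset.sum_neg_distrib]
      exact Finset.sum_le_sum fun i _ => (neg_le_abs _).trans (hab i (x i))
    linarith
  · intro x
    rw [← ENNReal.ofReal_prod_of_nonneg (fun i _ => (Real.exp_pos _).le), ← ENNReal.ofReal_mul (Real.exp_pos _).le,
      ← Real.exp_sum, ← Real.exp_add, sub_add_cancel, hexpφ x]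
  · filter_upwards [hsm] with p hp
    rw [← ENNReal.ofReal_mul (Real.exp_pos _).le, ← ENNReal.ofReal_mul (Real.exp_pos _).le, ← Real.exp_add,
      ← Real.exp_add]
    refine ENNReal.ofReal_le_ofReal (Real.exp_le_exp.2 ?_)
    have hS : ∑ i, a i (p.1 i) + ∑ i, a i (p.2 i) = ∑ i, a i ((p.1 ⊓ p.2) i) + ∑ i, a i ((p.1 ⊔ p.2) i) := by
      rw [← Finset.sum_add_distrib, ← Finset.sum_add_distrib]
      refine Finset.sum_congr rfl fun i _ => ?_
      simp only [Pi.inf_apply, Pi.sup_apply]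
      rcases le_total (p.1 i) (p.2 i) with h | h
      · rw [inf_eq_left.2 h, sup_eq_right.2 h]
      · rw [inf_eq_right.2 h, sup_eq_left.2 h, add_comm]
    linarith
  · filter_upwards [hmono] with p hp hle
    exact ENNReal.ofReal_le_ofReal (Real.exp_le_exp.2 (hp hle))

end Multiplicative

/-! ### R5: a Borel everywhere-MTP₂ version -/

section BorelVersion

/-- **A BOREL everywhere-MTP₂ version of an a.e.-MTP₂ density bounded away from `0` and `∞` (Lebesgue reference
measure; R5 of the cell).**  Let `f : ℝ^ι → [c, M]` (`0 < c ≤ M < ∞`) be measurable and MTP₂ on `λ ⊗ λ`-almost every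
pair.  Then there is a Borel measurable bounded `F` with `F = f` Lebesgue-a.e. and `F(x) F(y) ≤ F(x ∧ y) F(x ∨ y)`
for ALL `x, y`.  Proof: tilt (`exists_separable_tilt_mtp2`) — `f = g · ∏ᵢ uᵢ(xᵢ)` with `g` a.e.-MTP₂ and
a.e.-monotone — take the lower-corner envelope `F₀` of `g` (`exists_measurable_mtp2_version_of_ae_monotone`, typer
g20) and put the modular factor back: `F = F₀ · ∏ᵢ uᵢ(xᵢ)`.  Compare `exists_mtp2_version_of_ae` (a.e.-measurable
ultrafilter version, no lower bound needed) and `exists_aePair_latticeCondition_no_measurable_version` (no measurable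
version at all on the Hilbert cube). [this work] -/
theorem exists_measurable_mtp2_version_of_ae_of_pos (f : (ι → ℝ) → ℝ≥0∞) (hf : Measurable f) {c M : ℝ≥0∞}
    (hc : c ≠ 0) (hM : M ≠ ∞) (hcf : ∀ x, c ≤ f x) (hfM : ∀ x, f x ≤ M)
    (hMTP : ∀ᵐ p ∂(volume : Measure (ι → ℝ)).prod volume, f p.1 * f p.2 ≤ f (p.1 ⊓ p.2) * f (p.1 ⊔ p.2)) :
    ∃ F : (ι → ℝ) → ℝ≥0∞, Measurable F ∧ (∃ M' : ℝ≥0∞, M' ≠ ∞ ∧ ∀ x, F x ≤ M') ∧ F =ᵐ[volume] f ∧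
      ∀ x y, F x * F y ≤ F (x ⊓ y) * F (x ⊔ y) := by
  classical
  obtain ⟨u, g, M', hum, hu, hgm, hM', hgM', hfg, hgMTP, hgmono⟩ :=
    exists_separable_tilt_mtp2 f hf hc hM hcf hfM hMTP
  obtain ⟨F₀, hF₀m, hF₀M, hF₀g, hF₀mtp⟩ := exists_measurable_mtp2_version_of_ae_monotone g hgm hM' hgM' hgMTP hgmono
  refine ⟨fun x => F₀ x * ∏ i, u i (x i), ?_, ⟨M' * M' ^ Fintype.card ι, ?_, ?_⟩, ?_, ?_⟩
  · exact hF₀m.mul (Finset.measurable_prod _ fun i _ => (hum i).comp (measurable_pi_apply i))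
  · exact ENNReal.mul_ne_top hM' (ENNReal.pow_ne_top hM')
  · intro x
    refine mul_le_mul' (hF₀M x) ?_
    have h := Finset.prod_le_pow_card Finset.univ (fun i => u i (x i)) M' fun i _ => (hu i (x i)).2
    simpa only [Finset.card_univ] using h
  · filter_upwards [hF₀g] with x hx
    show F₀ x * ∏ i, u i (x i) = f x
    rw [hx, hfg x]
  · intro x y
    calc F₀ x * (∏ i, u i (x i)) * (F₀ y * ∏ i, u i (y i))
        = F₀ x * F₀ y * ((∏ i, u i (x i)) * ∏ i, u i (y i)) := mul_mul_mul_comm _ _ _ _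
      _ ≤ F₀ (x ⊓ y) * F₀ (x ⊔ y) * ((∏ i, u i ((x ⊓ y) i)) * ∏ i, u i ((x ⊔ y) i)) :=
          mul_le_mul' (hF₀mtp x y) (prod_mul_prod_eq_inf_sup u x y).le
      _ = F₀ (x ⊓ y) * (∏ i, u i ((x ⊓ y) i)) * (F₀ (x ⊔ y) * ∏ i, u i ((x ⊔ y) i)) :=
          (mul_mul_mul_comm _ _ _ _).symm

end BorelVersion

end Summit.CriticalPhenomena.PercolationContinuityZ3.Theorems.SahiAESeparableTilt

end
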